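import Mathlib
import Literature.Analysis.Complex.HarnackHalfPlane
import Literature.Analysis.Complex.UnivalentSequenceLimits
import Summits.QuantumFields.QCD.Theses.EulerDescent

/-!
# Stub `stub_harnackConeChord` of line `Sketch` for crux `EulerDescent.RayDescent`
(item stmt-QuantumFields-16900, route route-QuantumFields-EulerDescent, sub-problem QCD)

What is proved: the **sharp Harnack chord inequality of the right half-plane** — pure mathematics.
For `v : ℂ → ℝ` harmonic and non-negative on `H = {Re z > 0}` and `0 < x₁ ≤ x₂`,
`(x₁/x₂)·v(x₂) ≤ v(x₁)`, i.e. `x ↦ v(x)/x` is non-increasing along the positive real axis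
(Conway, *Functions of One Complex Variable I*, Ch. X §2, Harnack's inequality; the constant
`x₁/x₂` is the sharp Harnack constant `(1-ρ)/(1+ρ)` of the disc at hyperbolic distance
`log (x₂/x₁)`).

Proof: pull `v` back to the unit disc by the Cayley map `ψ(w) = x₂ (1 + w)/(1 - w)`, which maps
`B(0,1)` into `H` (`re ((1+w)/(1-w)) = (1 - |w|²)/|1 - w|² > 0`) with `ψ 0 = x₂` and
`ψ(-ρ) = x₁` for `ρ = (x₂ - x₁)/(x₁ + x₂) ∈ [0, 1)`.  The pull-back `v ∘ ψ` is harmonic on the disc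
(tree: `Literature.Analysis.Complex.harmonicOnNhd_comp_of_differentiableOn`), hence the real part
of a holomorphic `F` (Mathlib: `InnerProductSpace.HarmonicOnNhd.exists_analyticOnNhd_ball_re_eq`).
For `ε > 0` the map `Q = (F + ε)·I` is holomorphic on the disc with `im Q = v ∘ ψ + ε > 0`, so the
tree's disc Harnack inequality `Complex.im_apply_ge_harnack` at centre `0`, radius `1` and the
point `-ρ` gives `(v(x₂) + ε)(1-ρ)/(1+ρ) ≤ v(x₁) + ε`; finally `(1-ρ)/(1+ρ) = x₁/x₂` exactly and
`ε → 0⁺`.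

Pure theorem file (no definitions, no named facts): the registered stub signature verbatim.
-/

noncomputable section

namespace Summit.QuantumFields.QCD.Cruxes.RayDescent.Sketch

open Complex Metric Set InnerProductSpace

/-- The Cayley map `w ↦ (1 + w)/(1 - w)` sends the open unit disc into the right half-plane:
`re ((1 + w)/(1 - w)) = (1 - |w|²)/|1 - w|² > 0` for `|w| < 1`. [folklore] -/
private theorem re_one_add_div_one_sub_pos {w : ℂ} (hw : ‖w‖ < 1) :
    0 < ((1 + w) / (1 - w)).re := by
  have h1 : 1 - w ≠ 0 := by
    intro h
    have : ‖w‖ = 1 := by rw [sub_eq_zero] at h; rw [← h]; simp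
    linarith
  have hns : 0 < normSq (1 - w) := normSq_pos.2 h1
  have hw2 : w.re ^ 2 + w.im ^ 2 < 1 := by
    have h : ‖w‖ ^ 2 < 1 := by nlinarith [norm_nonneg w]
    rw [Complex.sq_norm, normSq_apply] at h
    nlinarith
  rw [div_re, ← add_div]
  refine div_pos ?_ hns
  simp only [add_re, one_re, sub_re, add_im, one_im, sub_im, zero_add, zero_sub]
  nlinarith

/-- (H) **The sharp Harnack chord of the right half-plane** (registered stub of line `Sketch`,
pure mathematics): a non-negative harmonic function `v` on `{Re z > 0}` satisfies
`(x₁/x₂)·v(x₂) ≤ v(x₁)` for `0 < x₁ ≤ x₂` — disc Harnack with the sharp constant, transported by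
the Cayley map `w ↦ x₂(1+w)/(1-w)`. [cite: Conway1978, Ch. X §2] -/
theorem stub_harnackConeChord :
    ∀ v : ℂ → ℝ, InnerProductSpace.HarmonicOnNhd v {z : ℂ | 0 < z.re} →
      (∀ z : ℂ, 0 < z.re → 0 ≤ v z) →
      ∀ x₁ x₂ : ℝ, 0 < x₁ → x₁ ≤ x₂ → x₁ / x₂ * v x₂ ≤ v x₁ := by
  intro v hv hv0 x₁ x₂ hx₁ hx₁₂
  have hx₂ : 0 < x₂ := lt_of_lt_of_le hx₁ hx₁₂
  have hs : 0 < x₁ + x₂ := by positivity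
  -- the Cayley map of the disc into the right half-plane, normalised by `ψ 0 = x₂`
  set ψ : ℂ → ℂ := fun w ↦ (x₂ : ℂ) * ((1 + w) / (1 - w)) with hψ
  have hne : ∀ w ∈ ball (0 : ℂ) 1, (1 : ℂ) - w ≠ 0 := by
    intro w hw h
    rw [mem_ball_zero_iff] at hw
    rw [sub_eq_zero] at h
    rw [← h] at hw
    simp at hw
  have hψd : DifferentiableOn ℂ ψ (ball 0 1) := by
    intro w hw
    have h1 : DifferentiableAt ℂ (fun w : ℂ ↦ (1 + w) / (1 - w)) w :=
      ((differentiableAt_const _).add differentiableAt_id).div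
        ((differentiableAt_const _).sub differentiableAt_id) (hne w hw)
    exact (h1.const_mul (x₂ : ℂ)).differentiableWithinAt
  have hψre : ∀ w ∈ ball (0 : ℂ) 1, 0 < (ψ w).re := by
    intro w hw
    show 0 < ((x₂ : ℂ) * ((1 + w) / (1 - w))).re
    rw [re_ofReal_mul]
    exact mul_pos hx₂ (re_one_add_div_one_sub_pos (mem_ball_zero_iff.1 hw))
  have hmaps : MapsTo ψ (ball 0 1) {z : ℂ | 0 < z.re} := fun w hw ↦ hψre w hw
  have hopen : IsOpen {z : ℂ | 0 < z.re} := isOpen_lt continuous_const Complex.continuous_re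
  -- `v ∘ ψ` is harmonic on the disc, hence the real part of a holomorphic `F`
  have hu : HarmonicOnNhd (fun w ↦ v (ψ w)) (ball 0 1) :=
    Literature.Analysis.Complex.harmonicOnNhd_comp_of_differentiableOn hv hopen hψd isOpen_ball
      hmaps
  obtain ⟨F, hFa, hFre⟩ := hu.exists_analyticOnNhd_ball_re_eq
  -- the two points: `ψ 0 = x₂` and `ψ (-ρ) = x₁`, `ρ = (x₂ - x₁)/(x₁ + x₂) ∈ [0,1)`
  set ρ : ℝ := (x₂ - x₁) / (x₁ + x₂) with hρ
  have hρ0 : 0 ≤ ρ := div_nonneg (by linarith) hs.le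
  have hρ1 : ρ < 1 := by rw [hρ, div_lt_one hs]; linarith
  have h1ρ : 1 - ρ = 2 * x₁ / (x₁ + x₂) := by rw [hρ]; field_simp; ring
  have h1ρ' : 1 + ρ = 2 * x₂ / (x₁ + x₂) := by rw [hρ]; field_simp; ring
  have hquot : (1 - ρ) / (1 + ρ) = x₁ / x₂ := by
    rw [h1ρ, h1ρ']
    field_simp
  set w₁ : ℂ := ((-ρ : ℝ) : ℂ) with hw₁
  have hw₁n : ‖w₁‖ = ρ := by
    rw [hw₁, norm_real, Real.norm_eq_abs, abs_neg, abs_of_nonneg hρ0]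
  have hw₁b : w₁ ∈ ball (0 : ℂ) 1 := mem_ball_zero_iff.2 (by rw [hw₁n]; exact hρ1)
  have h0b : (0 : ℂ) ∈ ball (0 : ℂ) 1 := mem_ball_self one_pos
  have hψ0 : ψ 0 = (x₂ : ℂ) := by simp [hψ]
  have hψ1 : ψ w₁ = (x₁ : ℂ) := by
    have h1 : (1 : ℂ) + w₁ = ((2 * x₁ / (x₁ + x₂) : ℝ) : ℂ) := by
      rw [← h1ρ, hw₁]; push_cast; ring
    have h2 : (1 : ℂ) - w₁ = ((2 * x₂ / (x₁ + x₂) : ℝ) : ℂ) := by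
      rw [← h1ρ', hw₁]; push_cast; ring
    show (x₂ : ℂ) * ((1 + w₁) / (1 - w₁)) = (x₁ : ℂ)
    rw [h1, h2]
    norm_cast
    field_simp
  -- Harnack's inequality on the unit disc for `Q = (F + ε) I`, `im Q = v ∘ ψ + ε > 0`
  have hchord : ∀ ε : ℝ, 0 < ε → (v x₂ + ε) * ((1 - ρ) / (1 + ρ)) ≤ v x₁ + ε := by
    intro ε hε
    set Q : ℂ → ℂ := fun w ↦ (F w + ε) * I with hQ
    have hQim : ∀ w ∈ ball (0 : ℂ) 1, (Q w).im = v (ψ w) + ε := by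
      intro w hw
      have e : (F w).re = v (ψ w) := hFre hw
      show ((F w + ε) * I).im = v (ψ w) + ε
      rw [mul_I_im, add_re, ofReal_re, e]
    have hQd : DifferentiableOn ℂ Q (ball 0 1) :=
      (hFa.differentiableOn.add_const _).mul_const _
    have hQpos : ∀ w ∈ ball (0 : ℂ) 1, 0 < (Q w).im := by
      intro w hw
      rw [hQim w hw]
      exact add_pos_of_nonneg_of_pos (hv0 _ (hψre w hw)) hε
    have h := Complex.im_apply_ge_harnack one_pos hQd hQpos hw₁b
    rw [sub_zero, hw₁n, hQim 0 h0b, hQim w₁ hw₁b, hψ0, hψ1] at h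
    exact h
  -- `ε → 0⁺`
  rw [hquot] at hchord
  refine le_of_forall_pos_le_add fun ε hε ↦ ?_
  have h := hchord ε hε
  have h' : (v x₂ + ε) * (x₁ / x₂) = x₁ / x₂ * v x₂ + ε * (x₁ / x₂) := by ring
  have h'' : 0 ≤ ε * (x₁ / x₂) := by positivity
  linarith

end Summit.QuantumFields.QCD.Cruxes.RayDescent.Sketch
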